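import Literature.Analysis.FluidPDE.Seregin2020SwirlMoserEnergyBound
import Literature.Analysis.FluidPDE.SobolevWholeSpace
import Literature.Analysis.FluidPDE.EnergyToolkit
import HarnessLib

/-!
# SwirlFreeBudget, crux K-18.1 `EtaMoserBound`, step A.4: the drift term of the `η` energy
# inequality is absorbed with the `L²` norm of the drift only (CTZ22 (eqA.5), `Γ ↦ η`)
# (seat nsreg-p4 g13)

Support file for the DORMANT route `SwirlThreshold` (crux stmt-NavierStokesRegularity-2002) and
planner nsreg-p2's ROUND-18 Appendix A (`R18-APPENDIX-EtaMoser.md`, §A.4: "Put `F := |η|^m`.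
Pointwise `|η|^{2m}|b·∇φ²| = 2F²φ|∇φ||b|` … Hölder … Sobolev `‖Fφ‖_{L⁶} ≤ N‖∇(Fφ)‖_{L²}` and the
ONLY input on the drift, `‖b(s)‖_{L²(B(x₀,ϱ′))}` … Young"; Chen–Tsai–Zhang arXiv:2201.01766,
Lemma 2.1, display (eqA.5)).  At a fixed time, for the energy-class function `g = Θ·s(F)`
(`Θ = ψ²` a squared cut-off, `H = s²` the convex profile):

* `four_mul_mul_le_of_pow_four_le` — the Young step with exponents `(4, 4/3)` in polynomial form:
  `P⁴ ≤ ΛY³ ⇒ 4BP ≤ δY + 27B⁴Λ/δ³` (certificate `a⁴ − 4a³b + 27b⁴ = (a − 3b)²(a² + 2ab + 3b²)`);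
* `integral_pow_six_le_of_contDiff` — the Gagliardo–Nirenberg–Sobolev inequality `H¹ ⊂ L⁶(ℝ³)`
  (the tree's `eLpNorm_six_le_eLpNorm_fderiv_two`) in real form for `C¹_c` functions:
  `∫ g⁶ ≤ C_S⁶ (∫‖Dg‖²)³`, `C_S = SNormLESNormFDerivOfEqConst ℝ volume 2`;
* `eta_transport_slice_le` — **the absorbed drift term**: for `Θ = ψ²` (`ψ ≥ 0`, `‖∇ψ‖ ≤ B`,
  `tsupport ψ ⊆ K` compact), `H = s²` with `s ≥ 0`, `2s'² ≤ H''`, `F ∈ C¹` and a continuous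
  drift `w`, for every `δ > 0`:
  `∫ H(F)⟪w, ∇Θ²⟫ ≤ δ (G_H + 2P) + 27 B⁴ C_S⁶ (∫_K ‖w‖²)² (∫_K H(F)) / δ³`,
  `G_H = ∫H''(F)|∇F|²Θ²`, `P = ∫H(F)|∇Θ|²` (pointwise `H⟪w,∇Θ²⟫ ≤ 4B‖w‖ ψ³ s(F)²`;
  Cauchy–Schwarz twice: `(∫‖w‖ψ³s²)⁴ ≤ (∫_K‖w‖²)² (∫ g⁶)(∫_K H(F))`; Sobolev for `g`; the tree's
  `Seregin2020.norm_fderiv_mul_comp_sq_le_at`: `‖∇g‖² ≤ H''|∇F|²Θ² + 2H|∇Θ|²`; Young).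

WHAT THIS IS NOT: not NS regularity — a fixed-time estimate; `EtaMoserBound` stays OPEN here; no
crux claim.
-/

-- the problem directory repeats the summit name (D-0017); core's `dupNamespace` linter fires
set_option linter.dupNamespace false

namespace Summit.NavierStokesRegularity.NavierStokesRegularity.Theorems.SwirlFreeBudget

open MeasureTheory Set Filter Topology Metric Function
open scoped RealInnerProductSpace ContDiff ENNReal NNReal
open Literature.Analysis Literature.Analysis.FluidPDE Literature.Analysis.FluidPDE.Seregin2020

noncomputable section

/-! ### The Young step -/

/-- **Young's inequality with exponents `(4, 4/3)`, polynomial form.**  If `P⁴ ≤ Λ Y³` with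
`B, P, Y, Λ ≥ 0` and `δ > 0`, then `4BP ≤ δY + 27B⁴Λ/δ³` (for `Y > 0`: with `a = δY`, `b = BP`,
`4a³b ≤ a⁴ + 27b⁴ = a⁴ + 27B⁴P⁴δ⁰ ≤ a⁴ + 27B⁴ΛY³`, the first inequality being
`(a − 3b)²(a² + 2ab + 3b²) ≥ 0`). -/
theorem four_mul_mul_le_of_pow_four_le {B P Y Λ δ : ℝ} (hB : 0 ≤ B) (hP : 0 ≤ P) (hY : 0 ≤ Y)
    (hΛ : 0 ≤ Λ) (hδ : 0 < δ) (h : P ^ 4 ≤ Λ * Y ^ 3) :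
    4 * B * P ≤ δ * Y + 27 * B ^ 4 * Λ / δ ^ 3 := by
  have hδ3 : 0 < δ ^ 3 := pow_pos hδ 3
  rw [show δ * Y + 27 * B ^ 4 * Λ / δ ^ 3 = (δ ^ 4 * Y + 27 * B ^ 4 * Λ) / δ ^ 3 by
    field_simp]
  rw [le_div_iff₀ hδ3]
  rcases eq_or_lt_of_le hY with hY0 | hYpos
  · -- `Y = 0` forces `P = 0`
    have hP4 : P ^ 4 = 0 := le_antisymm (by rw [← hY0] at h; simpa using h) (by positivity)
    have hP0 : P = 0 := pow_eq_zero_iff (n := 4) (by norm_num) |>.1 hP4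
    rw [hP0, ← hY0]
    nlinarith [mul_nonneg (by positivity : (0 : ℝ) ≤ 27 * B ^ 4) hΛ]
  · -- `Y > 0`
    have key : 4 * (B * P) * (δ * Y) ^ 3 ≤ (δ * Y) ^ 4 + 27 * (B * P) ^ 4 := by
      nlinarith [mul_nonneg (sq_nonneg (δ * Y - 3 * (B * P)))
        (by positivity : 0 ≤ (δ * Y) ^ 2 + 2 * (δ * Y) * (B * P) + 3 * (B * P) ^ 2)]
    have h27 : 27 * (B * P) ^ 4 ≤ 27 * B ^ 4 * Λ * Y ^ 3 := by
      have := mul_le_mul_of_nonneg_left h (by positivity : 0 ≤ 27 * B ^ 4)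
      calc 27 * (B * P) ^ 4 = 27 * B ^ 4 * P ^ 4 := by ring
        _ ≤ 27 * B ^ 4 * (Λ * Y ^ 3) := this
        _ = _ := by ring
    have hmain : (4 * B * P * δ ^ 3) * Y ^ 3 ≤ (δ ^ 4 * Y + 27 * B ^ 4 * Λ) * Y ^ 3 := by
      calc (4 * B * P * δ ^ 3) * Y ^ 3 = 4 * (B * P) * (δ * Y) ^ 3 := by ring
        _ ≤ (δ * Y) ^ 4 + 27 * (B * P) ^ 4 := key
        _ ≤ (δ * Y) ^ 4 + 27 * B ^ 4 * Λ * Y ^ 3 := by linarith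
        _ = (δ ^ 4 * Y + 27 * B ^ 4 * Λ) * Y ^ 3 := by ring
    exact le_of_mul_le_mul_right hmain (pow_pos hYpos 3)

/-! ### The Sobolev inequality in real form -/

/-- **`∫ g⁶ ≤ C_S⁶ (∫ ‖Dg‖²)³` for `g ∈ C¹_c(ℝ³)`** — the Gagliardo–Nirenberg–Sobolev inequality
`‖g‖_{L⁶} ≤ C_S ‖Dg‖_{L²}` (the tree's `eLpNorm_six_le_eLpNorm_fderiv_two`) with the `L^p` norms
written as real integrals. -/
theorem integral_pow_six_le_of_contDiff {g : EuclideanSpace ℝ (Fin 3) → ℝ} (hg : ContDiff ℝ 1 g)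
    (hgc : HasCompactSupport g) :
    ∫ x, g x ^ 6 ≤ (SNormLESNormFDerivOfEqConst ℝ (volume : Measure (EuclideanSpace ℝ (Fin 3))) 2 : ℝ) ^ 6 *
      (∫ x, ‖fderiv ℝ g x‖ ^ 2) ^ 3 := by
  set K : ℝ≥0 := SNormLESNormFDerivOfEqConst ℝ (volume : Measure (EuclideanSpace ℝ (Fin 3))) 2 with hK
  have cg : Continuous g := hg.continuous
  have cD : Continuous (fderiv ℝ g) := hg.continuous_fderiv one_ne_zero
  have mg6 : MemLp g 6 (volume : Measure (EuclideanSpace ℝ (Fin 3))) := cg.memLp_of_hasCompactSupport hgc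
  have mg2 : MemLp g 2 (volume : Measure (EuclideanSpace ℝ (Fin 3))) := cg.memLp_of_hasCompactSupport hgc
  have mD2 : MemLp (fderiv ℝ g) 2 (volume : Measure (EuclideanSpace ℝ (Fin 3))) :=
    cD.memLp_of_hasCompactSupport (hgc.fderiv (𝕜 := ℝ))
  have hSob := eLpNorm_six_le_eLpNorm_fderiv_two (volume : Measure (EuclideanSpace ℝ (Fin 3)))
    finrank_euclideanSpace_fin hg mg2.eLpNorm_lt_top
  -- the two norms as real numbers
  set A : ℝ := (∫ x, ‖g x‖ ^ (6 : ℝ)) ^ (6 : ℝ)⁻¹ with hA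
  set Bn : ℝ := (∫ x, ‖fderiv ℝ g x‖ ^ (2 : ℝ)) ^ (2 : ℝ)⁻¹ with hBn
  have hA0 : 0 ≤ A := Real.rpow_nonneg (integral_nonneg fun x => by positivity) _
  have hB0 : 0 ≤ Bn := Real.rpow_nonneg (integral_nonneg fun x => by positivity) _
  have e6 : eLpNorm g 6 (volume : Measure (EuclideanSpace ℝ (Fin 3))) = ENNReal.ofReal A := by
    rw [mg6.eLpNorm_eq_integral_rpow_norm (by norm_num) (by norm_num)]
    norm_num [hA]
  have e2 : eLpNorm (fderiv ℝ g) 2 (volume : Measure (EuclideanSpace ℝ (Fin 3))) = ENNReal.ofReal Bn := by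
    rw [mD2.eLpNorm_eq_integral_rpow_norm (by norm_num) (by norm_num)]
    norm_num [hBn]
  have hAB : A ≤ (K : ℝ) * Bn := by
    have h := hSob
    rw [e6, e2, ← ENNReal.ofReal_coe_nnreal, ← ENNReal.ofReal_mul K.coe_nonneg] at h
    exact (ENNReal.ofReal_le_ofReal_iff (mul_nonneg K.coe_nonneg hB0)).1 h
  have hpow : A ^ 6 ≤ ((K : ℝ) * Bn) ^ 6 := pow_le_pow_left₀ hA0 hAB 6
  -- unfold the powers
  have hI6 : 0 ≤ ∫ x, ‖g x‖ ^ (6 : ℝ) := integral_nonneg fun x => by positivity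
  have hI2 : 0 ≤ ∫ x, ‖fderiv ℝ g x‖ ^ (2 : ℝ) := integral_nonneg fun x => by positivity
  have eA6 : A ^ 6 = ∫ x, g x ^ 6 := by
    have h1 : A ^ 6 = ∫ x, ‖g x‖ ^ (6 : ℝ) := by
      rw [hA, ← Real.rpow_natCast _ 6, ← Real.rpow_mul hI6]
      norm_num
    rw [h1]
    refine integral_congr_ae (ae_of_all _ fun x => ?_)
    beta_reduce
    rw [show (6 : ℝ) = (6 : ℕ) by norm_num, Real.rpow_natCast, Real.norm_eq_abs, Even.pow_abs (by decide)]
  have eB2 : Bn ^ 2 = ∫ x, ‖fderiv ℝ g x‖ ^ 2 := by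
    have h1 : Bn ^ 2 = ∫ x, ‖fderiv ℝ g x‖ ^ (2 : ℝ) := by
      rw [hBn, ← Real.rpow_natCast _ 2, ← Real.rpow_mul hI2]
      norm_num
    rw [h1]
    refine integral_congr_ae (ae_of_all _ fun x => ?_)
    beta_reduce
    rw [show (2 : ℝ) = (2 : ℕ) by norm_num, Real.rpow_natCast]
  have eB6 : Bn ^ 6 = (∫ x, ‖fderiv ℝ g x‖ ^ 2) ^ 3 := by
    rw [← eB2]
    ring
  rw [← eA6]
  calc A ^ 6 ≤ ((K : ℝ) * Bn) ^ 6 := hpow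
    _ = (K : ℝ) ^ 6 * Bn ^ 6 := mul_pow _ _ _
    _ = _ := by rw [eB6]

/-! ### The absorbed drift term -/

/-- A continuous function is in `L²` of a compact set. -/
theorem memLp_two_restrict_of_continuous {u : EuclideanSpace ℝ (Fin 3) → ℝ} (hu : Continuous u)
    {K : Set (EuclideanSpace ℝ (Fin 3))} (hK : IsCompact K) : MemLp u 2 (volume.restrict K) := by
  rw [memLp_two_iff_integrable_sq hu.aestronglyMeasurable.restrict]
  exact (hu.pow 2).continuousOn.integrableOn_compact hK

/-- **The drift term of the `η` energy inequality, absorbed with `‖w‖_{L²}` only** (memo A.4 =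
Chen–Tsai–Zhang 2022 (eqA.5) with `Γ ↦ η`).  At a fixed time let `F ∈ C¹(ℝ³)`, `H = s²` with
`s ∈ C¹`, `s ≥ 0`, `2s'² ≤ H''`; `Θ = ψ²` with `ψ ∈ C¹`, `ψ ≥ 0`, `‖∇ψ‖ ≤ B`, `tsupport ψ ⊆ K`
compact; `w` a continuous field.  Then for every `δ > 0`,
`∫ H(F)⟪w, ∇Θ²⟫ ≤ δ (∫H''(F)|∇F|²Θ² + 2∫H(F)|∇Θ|²) + 27 B⁴ C_S⁶ (∫_K‖w‖²)² (∫_K H(F)) / δ³`. -/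
theorem eta_transport_slice_le {F : EuclideanSpace ℝ (Fin 3) → ℝ} (hF : ContDiff ℝ 1 F)
    {sf H : ℝ → ℝ} (hsf : ContDiff ℝ 1 sf) (hsf0 : ∀ v, 0 ≤ sf v) (hHs : ∀ v, H v = sf v ^ 2)
    (hH : ContDiff ℝ 2 H) (hs2 : ∀ v, 2 * deriv sf v ^ 2 ≤ deriv (deriv H) v)
    {w : EuclideanSpace ℝ (Fin 3) → EuclideanSpace ℝ (Fin 3)} (hw : Continuous w)
    {ψ Θ : EuclideanSpace ℝ (Fin 3) → ℝ} (hψ : ContDiff ℝ 1 ψ) (hψ0 : ∀ x, 0 ≤ ψ x)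
    (hΘψ : ∀ x, Θ x = ψ x ^ 2) {B : ℝ} (hB : 0 ≤ B) (hBψ : ∀ x, ‖gradient ψ x‖ ≤ B)
    {K : Set (EuclideanSpace ℝ (Fin 3))} (hK : IsCompact K) (hψK : tsupport ψ ⊆ K)
    {δ : ℝ} (hδ : 0 < δ) :
    ∫ x, H (F x) * ⟪w x, gradient (fun y => Θ y ^ 2) x⟫ ≤
      δ * ((∫ x, deriv (deriv H) (F x) * ‖gradient F x‖ ^ 2 * Θ x ^ 2) +
          2 * ∫ x, H (F x) * ‖gradient Θ x‖ ^ 2) +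
        27 * B ^ 4 * ((SNormLESNormFDerivOfEqConst ℝ (volume : Measure (EuclideanSpace ℝ (Fin 3))) 2 : ℝ) ^ 6 *
          (∫ x in K, ‖w x‖ ^ 2) ^ 2 * ∫ x in K, H (F x)) / δ ^ 3 := by
  set CS : ℝ := (SNormLESNormFDerivOfEqConst ℝ (volume : Measure (EuclideanSpace ℝ (Fin 3))) 2 : ℝ) with hCS
  have hCS0 : 0 ≤ CS := NNReal.coe_nonneg _
  -- regularity
  have hΘfun : Θ = fun y => ψ y ^ 2 := funext hΘψ
  have hΘ : ContDiff ℝ 1 Θ := by rw [hΘfun]; exact hψ.pow 2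
  have hKc : IsClosed K := hK.isClosed
  have hψc : HasCompactSupport ψ := hK.of_isClosed_subset (isClosed_tsupport _) hψK
  have hψ0K : ∀ x, x ∉ K → ψ x = 0 := fun x hx => image_eq_zero_of_notMem_tsupport fun h => hx (hψK h)
  have hΘ0K : ∀ x, x ∉ K → Θ x = 0 := fun x hx => by rw [hΘψ, hψ0K x hx]; ring
  have hΘK : tsupport Θ ⊆ K := closure_minimal (fun y hy => by by_contra h'; exact hy (hΘ0K y h')) hKc
  have hΘ0 : ∀ x, 0 ≤ Θ x := fun x => by rw [hΘψ]; exact sq_nonneg _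
  have hH' : ContDiff ℝ 1 (deriv H) := by
    have h2' : ContDiff ℝ (1 + 1) H := by rw [one_add_one_eq_two]; exact hH
    exact h2'.deriv'
  have cF : Continuous F := hF.continuous
  have csF : Continuous fun x => sf (F x) := hsf.continuous.comp cF
  have cHF : Continuous fun x => H (F x) := hH.continuous.comp cF
  have cψ : Continuous ψ := hψ.continuous
  have cΘ : Continuous Θ := hΘ.continuous
  have cw : Continuous fun x => ‖w x‖ := hw.norm
  have cgΘ : Continuous (gradient Θ) := continuous_gradient_of_contDiff hΘ
  have cgΘ2 : Continuous (gradient fun y => Θ y ^ 2) := continuous_gradient_of_contDiff (hΘ.pow 2)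
  have cgF : Continuous (gradient F) := continuous_gradient_of_contDiff hF
  have hsupp : ∀ {u : EuclideanSpace ℝ (Fin 3) → ℝ}, Continuous u → (∀ x, x ∉ K → u x = 0) → Integrable u :=
    fun hu h0 => hu.integrable_of_hasCompactSupport (HasCompactSupport.intro hK h0)
  -- the energy-class function `g = Θ s(F)`
  set g : EuclideanSpace ℝ (Fin 3) → ℝ := fun y => Θ y * sf (F y) with hg
  have hgC : ContDiff ℝ 1 g := hΘ.mul (hsf.comp hF)
  have hg0K : ∀ x, x ∉ K → g x = 0 := fun x hx => by simp [hg, hΘ0K x hx]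
  have hgc : HasCompactSupport g := HasCompactSupport.intro hK hg0K
  have hgK : tsupport g ⊆ K := closure_minimal (fun y hy => by by_contra h'; exact hy (hg0K y h')) hKc
  have hg0 : ∀ x, 0 ≤ g x := fun x => mul_nonneg (hΘ0 x) (hsf0 _)
  have cg : Continuous g := hgC.continuous
  -- the quantities
  set GH : ℝ := ∫ x, deriv (deriv H) (F x) * ‖gradient F x‖ ^ 2 * Θ x ^ 2 with hGH
  set Pf : ℝ := ∫ x, H (F x) * ‖gradient Θ x‖ ^ 2 with hPf
  set w2 : ℝ := ∫ x in K, ‖w x‖ ^ 2 with hw2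
  set m : ℝ := ∫ x in K, H (F x) with hm
  set Y : ℝ := ∫ x, ‖fderiv ℝ g x‖ ^ 2 with hY
  set S6 : ℝ := ∫ x, g x ^ 6 with hS6
  set J : ℝ := ∫ x, ψ x ^ 6 * sf (F x) ^ 4 with hJ
  set P : ℝ := ∫ x, ‖w x‖ * (ψ x ^ 3 * sf (F x) ^ 2) with hP
  have hw2_0 : 0 ≤ w2 := integral_nonneg fun x => by positivity
  have hm0 : 0 ≤ m := integral_nonneg fun x => by rw [hHs]; positivity
  have hY0 : 0 ≤ Y := integral_nonneg fun x => by positivity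
  have hS60 : 0 ≤ S6 := integral_nonneg fun x => by positivity
  have hJ0 : 0 ≤ J := integral_nonneg fun x => mul_nonneg (by positivity) (by positivity)
  have hP0 : 0 ≤ P := integral_nonneg fun x =>
    mul_nonneg (norm_nonneg _) (mul_nonneg (pow_nonneg (hψ0 x) 3) (sq_nonneg _))
  -- (1) pointwise bound of the transport integrand and `T_W ≤ 4 B P`
  have hpt : ∀ x, H (F x) * ⟪w x, gradient (fun y => Θ y ^ 2) x⟫ ≤
      4 * B * (‖w x‖ * (ψ x ^ 3 * sf (F x) ^ 2)) := by
    intro x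
    have e1 : gradient (fun y => Θ y ^ 2) x = (4 * ψ x ^ 3) • gradient ψ x := by
      rw [gradient_sq_apply hΘ x, hΘfun, gradient_sq_apply hψ x, smul_smul]
      congr 1
      ring
    rw [e1, inner_smul_right, hHs]
    have hin : ⟪w x, gradient ψ x⟫ ≤ ‖w x‖ * B :=
      (real_inner_le_norm _ _).trans (mul_le_mul_of_nonneg_left (hBψ x) (norm_nonneg _))
    have h3 : 0 ≤ ψ x ^ 3 := pow_nonneg (hψ0 x) 3
    have h4 : 0 ≤ sf (F x) ^ 2 := sq_nonneg _
    nlinarith [mul_nonneg h4 h3, mul_le_mul_of_nonneg_left hin (mul_nonneg h4 h3)]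
  have iTW : Integrable fun x => H (F x) * ⟪w x, gradient (fun y => Θ y ^ 2) x⟫ :=
    hsupp (cHF.mul (hw.inner cgΘ2)) (fun x hx => by
      show H (F x) * ⟪w x, gradient (fun y => Θ y ^ 2) x⟫ = 0
      rw [gradient_sq_eq_zero_of_notMem (fun h => hx (hΘK h)), inner_zero_right, mul_zero])
  have iPint : Integrable fun x => ‖w x‖ * (ψ x ^ 3 * sf (F x) ^ 2) :=
    hsupp (cw.mul ((cψ.pow 3).mul (csF.pow 2))) (fun x hx => by simp [hψ0K x hx])
  have hTW : ∫ x, H (F x) * ⟪w x, gradient (fun y => Θ y ^ 2) x⟫ ≤ 4 * B * P := by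
    rw [hP, ← MeasureTheory.integral_const_mul]
    exact integral_mono iTW (iPint.const_mul _) hpt
  -- (2) first Cauchy–Schwarz: `P² ≤ w2 · J`
  have hP2 : P ^ 2 ≤ w2 * J := by
    have ePK : (∫ x in K, ‖w x‖ * (ψ x ^ 3 * sf (F x) ^ 2)) = P :=
      setIntegral_eq_integral_of_forall_compl_eq_zero fun x hx => by simp [hψ0K x hx]
    have eJK : (∫ x in K, (ψ x ^ 3 * sf (F x) ^ 2) ^ 2) = J := by
      have e1 : (∫ x in K, ψ x ^ 6 * sf (F x) ^ 4) = ∫ x, ψ x ^ 6 * sf (F x) ^ 4 :=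
        setIntegral_eq_integral_of_forall_compl_eq_zero fun x hx => by simp [hψ0K x hx]
      rw [hJ, ← e1]
      refine setIntegral_congr_fun hKc.measurableSet fun x _ => ?_
      ring
    have hcs := integral_mul_le_sqrt_mul_sqrt_of_memLp
      (memLp_two_restrict_of_continuous (u := fun x => ‖w x‖) cw hK)
      (memLp_two_restrict_of_continuous (u := fun x => ψ x ^ 3 * sf (F x) ^ 2)
        ((cψ.pow 3).mul (csF.pow 2)) hK)
    rw [ePK, eJK] at hcs
    calc P ^ 2 ≤ (Real.sqrt w2 * Real.sqrt J) ^ 2 := pow_le_pow_left₀ hP0 hcs 2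
      _ = w2 * J := by rw [mul_pow, Real.sq_sqrt hw2_0, Real.sq_sqrt hJ0]
  -- (3) second Cauchy–Schwarz: `J² ≤ S6 · m`
  have hJ2 : J ^ 2 ≤ S6 * m := by
    have eJK : (∫ x in K, g x ^ 3 * sf (F x)) = J := by
      have e1 : (∫ x in K, ψ x ^ 6 * sf (F x) ^ 4) = ∫ x, ψ x ^ 6 * sf (F x) ^ 4 :=
        setIntegral_eq_integral_of_forall_compl_eq_zero fun x hx => by simp [hψ0K x hx]
      rw [hJ, ← e1]
      refine setIntegral_congr_fun hKc.measurableSet fun x _ => ?_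
      simp only [hg, hΘψ]
      ring
    have eSK : (∫ x in K, (g x ^ 3) ^ 2) = S6 := by
      have e1 : (∫ x in K, g x ^ 6) = ∫ x, g x ^ 6 :=
        setIntegral_eq_integral_of_forall_compl_eq_zero fun x hx => by simp [hg0K x hx]
      rw [hS6, ← e1]
      refine setIntegral_congr_fun hKc.measurableSet fun x _ => ?_
      ring
    have emK : (∫ x in K, sf (F x) ^ 2) = m := by
      rw [hm]
      exact setIntegral_congr_fun hKc.measurableSet fun x _ => (hHs _).symm
    have hcs := integral_mul_le_sqrt_mul_sqrt_of_memLp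
      (memLp_two_restrict_of_continuous (u := fun x => g x ^ 3) (cg.pow 3) hK)
      (memLp_two_restrict_of_continuous (u := fun x => sf (F x)) csF hK)
    rw [eJK, eSK, emK] at hcs
    calc J ^ 2 ≤ (Real.sqrt S6 * Real.sqrt m) ^ 2 := pow_le_pow_left₀ hJ0 hcs 2
      _ = S6 * m := by rw [mul_pow, Real.sq_sqrt hS60, Real.sq_sqrt hm0]
  -- (4) Sobolev: `S6 ≤ C_S⁶ Y³`
  have hS6 : S6 ≤ CS ^ 6 * Y ^ 3 := integral_pow_six_le_of_contDiff hgC hgc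
  -- (5) `Y ≤ G_H + 2 P`
  have hYle : Y ≤ GH + 2 * Pf := by
    have iGH : Integrable fun x => deriv (deriv H) (F x) * ‖gradient F x‖ ^ 2 * Θ x ^ 2 :=
      hsupp ((((hH'.continuous_deriv le_rfl).comp cF).mul (cgF.norm.pow 2)).mul (cΘ.pow 2))
        (fun x hx => by simp [hΘ0K x hx])
    have iPf : Integrable fun x => H (F x) * ‖gradient Θ x‖ ^ 2 :=
      hsupp (cHF.mul (cgΘ.norm.pow 2)) (fun x hx => by
        rw [gradient_eq_zero_of_notMem_tsupport (fun h => hx (hΘK h)), norm_zero]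
        ring)
    have hptY : ∀ x, ‖fderiv ℝ g x‖ ^ 2 ≤
        deriv (deriv H) (F x) * ‖gradient F x‖ ^ 2 * Θ x ^ 2 + 2 * (H (F x) * ‖gradient Θ x‖ ^ 2) := by
      intro x
      have h := norm_fderiv_mul_comp_sq_le_at ((hF.differentiable one_ne_zero) x)
        ((hΘ.differentiable one_ne_zero) x) hsf hs2
      rw [hHs]
      calc ‖fderiv ℝ g x‖ ^ 2 ≤ _ := h
        _ = _ := by ring
    have iY : Integrable fun x => ‖fderiv ℝ g x‖ ^ 2 :=
      hsupp ((hgC.continuous_fderiv one_ne_zero).norm.pow 2) (fun x hx => by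
        rw [fderiv_of_notMem_tsupport ℝ (fun h => hx (hgK h)), norm_zero]
        ring)
    calc Y ≤ ∫ x, (deriv (deriv H) (F x) * ‖gradient F x‖ ^ 2 * Θ x ^ 2 + 2 * (H (F x) * ‖gradient Θ x‖ ^ 2)) :=
          integral_mono iY (iGH.add (iPf.const_mul 2)) hptY
      _ = GH + 2 * Pf := by
          rw [integral_add iGH (iPf.const_mul 2), MeasureTheory.integral_const_mul]
  -- (6) `P⁴ ≤ Λ Y³`, Young, conclusion
  have hP4 : P ^ 4 ≤ (CS ^ 6 * w2 ^ 2 * m) * Y ^ 3 := by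
    calc P ^ 4 = (P ^ 2) ^ 2 := by ring
      _ ≤ (w2 * J) ^ 2 := pow_le_pow_left₀ (sq_nonneg _) hP2 2
      _ = w2 ^ 2 * J ^ 2 := by ring
      _ ≤ w2 ^ 2 * (S6 * m) := mul_le_mul_of_nonneg_left hJ2 (sq_nonneg _)
      _ ≤ w2 ^ 2 * (CS ^ 6 * Y ^ 3 * m) :=
          mul_le_mul_of_nonneg_left (mul_le_mul_of_nonneg_right hS6 hm0) (sq_nonneg _)
      _ = (CS ^ 6 * w2 ^ 2 * m) * Y ^ 3 := by ring
  have hyoung := four_mul_mul_le_of_pow_four_le hB hP0 hY0 (by positivity) hδ hP4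
  have hGP : 0 ≤ GH + 2 * Pf - Y := sub_nonneg.2 hYle
  calc ∫ x, H (F x) * ⟪w x, gradient (fun y => Θ y ^ 2) x⟫ ≤ 4 * B * P := hTW
    _ ≤ δ * Y + 27 * B ^ 4 * (CS ^ 6 * w2 ^ 2 * m) / δ ^ 3 := hyoung
    _ ≤ δ * (GH + 2 * Pf) + 27 * B ^ 4 * (CS ^ 6 * w2 ^ 2 * m) / δ ^ 3 := by
        nlinarith [mul_nonneg hδ.le hGP]

end

end Summit.NavierStokesRegularity.NavierStokesRegularity.Theorems.SwirlFreeBudget
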